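import Summits.ValiantsHypothesis.ValiantsHypothesis.Theses.SOSTau

/-!
# Negative lemmas around crux `SOSTau` (route SOSTau, item stmt-ValiantsHypothesis-18748)

Refuter birth-vetting artefacts.  None of these refutes `SOSTau` itself; they pin down which
features of the typed statement are load-bearing:

* `not_sosTau_with_multiplicity` — counting real zeros WITH multiplicity (dropping `toFinset`) is
  false: `X^(2c+2) = 1·(X^(c+1))²` has the zero `0` with multiplicity `2c+2 > c·1`.  So the printed
  "number of real zeros" must be (and in the route file is) the number of DISTINCT real zeros.
* `sosTau_constant_ne_zero` — the constant cannot be `0`: `X² − 1 = 1·X² + (−1)·1²` has a real zero.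
  (The Chebyshev calibration `c ≥ 4` is the route's support item `ChebyshevCalibration`.)
-/

set_option linter.dupNamespace false

namespace Summit.ValiantsHypothesis.ValiantsHypothesis.Theorems.SOSTau.Negative

open Polynomial

/-- The multiplicity-counting strengthening of `SOSTau` (roots as a multiset, no `toFinset`) is
FALSE.  Witness: `s = 1`, `a = 1`, `g = X^(c+1)`; then `f = X^(2c+2)` has the real zero `0` with
multiplicity `2c+2 > c = c·|supp g|`. [folklore] -/
theorem not_sosTau_with_multiplicity :
    ¬ ∃ c : ℕ, ∀ (s : ℕ) (a : Fin s → ℝ) (g : Fin s → Polynomial ℝ),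
      Multiset.card (∑ i, Polynomial.C (a i) * g i ^ 2).roots ≤ c * ∑ i, (g i).support.card := by
  rintro ⟨c, hc⟩
  have h := hc 1 (fun _ => 1) (fun _ => X ^ (c + 1))
  simp only [Fin.sum_univ_one, map_one, one_mul, ← pow_mul, Polynomial.roots_X_pow,
    Multiset.card_nsmul, Multiset.card_singleton, mul_one] at h
  rw [Polynomial.support_X_pow (c + 1), Finset.card_singleton, mul_one] at h
  omega

/-- The constant in `SOSTau` cannot be `0`. -/
theorem sosTau_constant_ne_zero (c : ℕ)
    (hc : ∀ (s : ℕ) (a : Fin s → ℝ) (g : Fin s → Polynomial ℝ),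
      (∑ i, Polynomial.C (a i) * g i ^ 2).roots.toFinset.card ≤ c * ∑ i, (g i).support.card) :
    c ≠ 0 := by
  rintro rfl
  have h0 := hc 2 ![1, -1] ![X, 1]
  simp only [Fin.sum_univ_two, Matrix.cons_val_zero, Matrix.cons_val_one,
    zero_mul, Nat.le_zero, Finset.card_eq_zero] at h0
  have hp : (C (1:ℝ) * X ^ 2 + C (-1) * 1 ^ 2 : Polynomial ℝ) = X ^ 2 - 1 := by
    simp [sub_eq_add_neg]
  rw [hp] at h0
  have hne : (X ^ 2 - 1 : Polynomial ℝ) ≠ 0 := by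
    intro hz
    have := congrArg (Polynomial.eval 0) hz
    simp at this
  have hmem : (1:ℝ) ∈ (X ^ 2 - 1 : Polynomial ℝ).roots.toFinset := by
    rw [Multiset.mem_toFinset, Polynomial.mem_roots hne]
    simp
  rw [h0] at hmem
  simp at hmem

end Summit.ValiantsHypothesis.ValiantsHypothesis.Theorems.SOSTau.Negative
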